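import Literature.AlgebraicGeometry.Motives.FrobeniusFixedClassesKunnethFullyAlgebraicFactor
import HarnessLib

/-!
# Tate's theorem transported along a factor with fully algebraic cohomology:
# two Künneth-decomposable subspaces of `H^{2c}(X × Z)` agree iff their pieces agree; the `T′`-form
# `K·Aᶜ = Ker(φ_c − 1)` and Tate's condition (b) `T′ᶜ ∧ T′^{c′} ∧ Sᶜ` pass from `X` to `X × Z`, hence
# hom = num on `X × Z` and «order of the pole = rank» for `Z(X × Z, T)`

Topic `Literature/AlgebraicGeometry/Motives`; THEOREMS ONLY (no definition, no instance, no named fact;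
D-0026).

J. Tate, *Conjectures on algebraic cycles in ℓ-adic cohomology* (1994) Th. 2.9, in the tree's form
(`TateConjectureStrongFormFiniteField.tate_a_iff_b`, `ZetaFunctionPoleOrderTateConjecture.hasPoleOfOrderAt_zetaSeries_rank_iff'`;
Milne 2007 Th. 1.2; Kahn 2020 Th. 6.53): for `X` smooth projective of dimension `d` over `𝔽_q` and `r + s = d`,
`(a) T′ʳ ∧ Eʳ ⟺ (b) T′ʳ ∧ T′ˢ ∧ Sʳ ⟺ (c) ord_{q^{−r}} Z(X, T) = ρ_r`, where `T′ʳ(X)` is «`K·Aʳ(X) = Ker(φ_r − 1)`»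
(Milne 1986's `T′`), `Sʳ` is «`Ker(φ_r − 1) ∩ (φ_r − 1)H = 0`», `Eʳ` is hom = num in codimension `r` and `ρ_r` the
rank of the codimension-`r` cycles modulo numerical equivalence.  Rows g53-#1 … g53-#5 decomposed
`K·Aᶜ(X × Z)`, `Ker(φ_c − 1 | X × Z)` and `H^{2c}(X × Z)(c)_1` along the Künneth isomorphism for a factor `Z`
with `K·A^q(Z) = H^{2q}(Z)` for all `q` and `b_{odd}(Z) = 0`.  Here:

* §1 (any `W`) **two Künneth-decomposable subspaces of `H^{2c}(X × Z)` — `z ∈ A ⟺ z_{2p,2q} ∈ U_p ⊗ H^{2q}(Z)`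
  for all `p + q = c` — satisfy `A ≤ A′` iff `U_p ≤ U′_p` for every `p` with `H^{2q}(Z) ≠ 0`**, and `A = A′`
  iff `U_p = U′_p` for those `p` (`le_iff_of_kunneth_pieces`, `eq_iff_of_kunneth_pieces`; the component image of
  such an `A` is `U_p ⊗ H^{2q}(Z)`, `map_kunnethComponent_eq_of_mem_iff`).
* §2 (any field, any `g ∈ Γ_k`) the `T′`-form transfers: **`K·Aᶜ(X × Z) = Ker(g − 1)` iff
  `K·Aᵖ(X) = Ker(g − 1)` for every `p + q = c` with `H^{2q}(Z) ≠ 0`** (`algebraicClasses_eq_ker_sub_one_tensor_iff`).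
* §3 (`k` finite, `g = φ`) **Tate's condition (b) for `X` in all pairs `(r, s)`, `r + s = n`, implies (b) for
  `X × Z` in all pairs `(c, c′)`** (`tate_b_tensor_of_forall`), hence — Tate's theorem for
  `X × Z` — `Tᶜ(X × Z)`, `T^{c′}(X × Z)`, hom = num in codimensions `c`, `c′`, `S` (`consequences_tensor_of_forall_tate_b`),
  and, granted RH for `X` and `Z` in `E`, **the pole of `Z(X × Z, T)` at `q^{−c}` has order exactly the rank
  `ρ_c(X × Z)`** (`hasPoleOfOrderAt_zetaSeries_tensor_rank_of_forall_tate_b`; Tate 1965 (12) for `X × Z`).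
* §4 `Z = 𝐏ʳ`: `tate_b_tensor_projectiveSpace_of_forall`, `consequences_tensor_projectiveSpace_of_forall_tate_b`.

HC is not touched.

## References

* [Tate1994] J. Tate, *Conjectures on algebraic cycles in ℓ-adic cohomology*, PSPM 55.1 (1994), §1, §2 Th. 2.9.
* [TateWoodsHole1965] J. Tate, *Algebraic cycles and poles of zeta functions* (1965), §3 (12)–(13).
* [Milne2007TateFiniteFieldsAIM] J. S. Milne, *The Tate conjecture over finite fields (AIM talk)*,
  arXiv:0709.3040, §1 Th. 1.2, §2 Cor. 2.2.
* [Milne1986ValuesZetaFunctionsFiniteFields] J. S. Milne, *Values of zeta functions of varieties over finite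
  fields*, Amer. J. Math. 108 (1986), §8 Prop. 8.2–8.4 (`T`, `T′`, `SS`).
* [Kahn2020] B. Kahn, *Zeta and L-Functions of Varieties and Motives* (2020), §6.14 Conj. 6.52, Th. 6.53.
* [Roman2008] S. Roman, *Advanced Linear Algebra* (2008), Ch. 14 Th. 14.5–14.6.
* Tree: rows g53-#1 … g53-#5; `TateConjectureStrongFormFiniteField` (`tate_a_iff_b`, `consequences_of_tate_a`,
  `algebraicClasses_le_ker_sub_one`), `ZetaFunctionPoleOrderTateConjecture` (`hasPoleOfOrderAt_zetaSeries_rank_iff'`),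
  `FrobeniusCharpolyKunnethProducts` (`weilRiemannHypothesisFor_tensor`), `ProjectiveSpaceFiniteFieldCohomology`.

## Provenance

Lane `lit-hodgefound` (summit `HodgeConjecture`, Track 2 foundations library, Layer B: motives ∕ Tate's
conjecture over finite fields), seat `lit-hodgefound-p29` (literature-prover, generation 53, row g53-#6).
-/

universe u v

open CategoryTheory AlgebraicGeometry MonoidalCategory CartesianMonoidalCategory
open Finset.HasAntidiagonal (antidiagonal mem_antidiagonal)
open scoped TensorProduct

noncomputable section

namespace Literature.AlgebraicGeometry.Motives

/-! ### §1 Künneth-decomposable subspaces are compared piece by piece -/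

namespace WeilCohomology

open Literature.LinearAlgebra.TensorContraction

variable {k : Type u} [Field k] {K : Type v} [Field K] [CharZero K] (W : WeilCohomology k K)
variable {n m : ℕ} {X Z : SchemeOver k}

/-- **The `(2p, 2q)` component image of a Künneth-decomposable subspace `A` (`z ∈ A ⟺ z_{2p,2q} ∈ U_p ⊗ H^{2q}(Z)`
for all `p + q = c`) is `U_p ⊗ H^{2q}(Z)`**: `x ⊗ w ↦ x × w ∈ A` is a section of the component.
[cite: Kleiman1968AlgebraicCycles, §1.2 (B)] [cite: Roman2008, Ch. 14 Th. 14.6] -/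
theorem map_kunnethComponent_eq_of_mem_iff (hX : IsSmoothProjective n X) (hZ : IsSmoothProjective m Z) {c : ℕ}
    {A : Submodule K (W.obj (X ⊗ Z) (2 * c))} {U : ∀ p : ℕ, Submodule K (W.obj X (2 * p))}
    (hA : ∀ z, z ∈ A ↔ ∀ (p q : ℕ) (h : 2 * p + 2 * q = 2 * c), W.kunnethComponent hX hZ (2 * p) (2 * q) h z ∈
      Submodule.map₂ (TensorProduct.mk K (W.obj X (2 * p)) (W.obj Z (2 * q))) (U p) ⊤)
    {p q : ℕ} (h : 2 * p + 2 * q = 2 * c) :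
    A.map (W.kunnethComponent hX hZ (2 * p) (2 * q) h) =
      Submodule.map₂ (TensorProduct.mk K (W.obj X (2 * p)) (W.obj Z (2 * q))) (U p) ⊤ := by
  refine le_antisymm ?_ fun t ht ↦ ?_
  · rintro _ ⟨z, hz, rfl⟩
    exact (hA z).mp hz p q h
  · refine ⟨W.extTensor h t, (hA _).mpr fun p' q' h' ↦ ?_, W.kunnethComponent_extTensor_self hX hZ h t⟩
    by_cases hpq : (2 * p', 2 * q') = (2 * p, 2 * q)
    · obtain ⟨hp, hq⟩ := Prod.mk.inj hpq
      obtain rfl : p' = p := by omega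
      obtain rfl : q' = q := by omega
      rw [W.kunnethComponent_extTensor_self hX hZ]
      exact ht
    · rw [W.kunnethComponent_extTensor_of_ne hX hZ h' h hpq]
      exact Submodule.zero_mem _

/-- **Künneth-decomposable subspaces are compared piece by piece (`≤`)**: for `A`, `A′ ⊆ H^{2c}(X × Z)` with
`z ∈ A ⟺ ∀ p+q=c, z_{2p,2q} ∈ U_p ⊗ H^{2q}(Z)` and likewise `A′`, `U′`: `A ≤ A′` iff `U_p ≤ U′_p` for every
`p + q = c` with `H^{2q}(Z) ≠ 0`. [cite: Roman2008, Ch. 14 Th. 14.5–14.6] [cite: Kleiman1968AlgebraicCycles, §1.2 (B)] -/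
theorem le_iff_of_kunneth_pieces (hX : IsSmoothProjective n X) (hZ : IsSmoothProjective m Z) {c : ℕ}
    {A A' : Submodule K (W.obj (X ⊗ Z) (2 * c))} {U U' : ∀ p : ℕ, Submodule K (W.obj X (2 * p))}
    (hA : ∀ z, z ∈ A ↔ ∀ (p q : ℕ) (h : 2 * p + 2 * q = 2 * c), W.kunnethComponent hX hZ (2 * p) (2 * q) h z ∈
      Submodule.map₂ (TensorProduct.mk K (W.obj X (2 * p)) (W.obj Z (2 * q))) (U p) ⊤)
    (hA' : ∀ z, z ∈ A' ↔ ∀ (p q : ℕ) (h : 2 * p + 2 * q = 2 * c), W.kunnethComponent hX hZ (2 * p) (2 * q) h z ∈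
      Submodule.map₂ (TensorProduct.mk K (W.obj X (2 * p)) (W.obj Z (2 * q))) (U' p) ⊤) :
    A ≤ A' ↔ ∀ p q : ℕ, p + q = c → Nontrivial (W.obj Z (2 * q)) → U p ≤ U' p := by
  constructor
  · intro hle p q hpq hq
    have h : 2 * p + 2 * q = 2 * c := by omega
    haveI := hq
    refine le_of_map₂_top_le_map₂_top (W := W.obj Z (2 * q)) ?_
    rw [← W.map_kunnethComponent_eq_of_mem_iff hX hZ hA h, ← W.map_kunnethComponent_eq_of_mem_iff hX hZ hA' h]
    exact Submodule.map_mono hle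
  · intro hle z hz
    refine (hA' z).mpr fun p q h ↦ ?_
    rcases subsingleton_or_nontrivial (W.obj Z (2 * q)) with hq | hq
    · rw [eq_zero_of_subsingleton_right (W.kunnethComponent hX hZ (2 * p) (2 * q) h z)]
      exact Submodule.zero_mem _
    · exact Submodule.map₂_le_map₂_left (hle p q (by omega) hq) ((hA z).mp hz p q h)

/-- **Künneth-decomposable subspaces agree iff their pieces agree** on every `p + q = c` with `H^{2q}(Z) ≠ 0`.
[cite: Roman2008, Ch. 14 Th. 14.5–14.6] [cite: Kleiman1968AlgebraicCycles, §1.2 (B)] -/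
theorem eq_iff_of_kunneth_pieces (hX : IsSmoothProjective n X) (hZ : IsSmoothProjective m Z) {c : ℕ}
    {A A' : Submodule K (W.obj (X ⊗ Z) (2 * c))} {U U' : ∀ p : ℕ, Submodule K (W.obj X (2 * p))}
    (hA : ∀ z, z ∈ A ↔ ∀ (p q : ℕ) (h : 2 * p + 2 * q = 2 * c), W.kunnethComponent hX hZ (2 * p) (2 * q) h z ∈
      Submodule.map₂ (TensorProduct.mk K (W.obj X (2 * p)) (W.obj Z (2 * q))) (U p) ⊤)
    (hA' : ∀ z, z ∈ A' ↔ ∀ (p q : ℕ) (h : 2 * p + 2 * q = 2 * c), W.kunnethComponent hX hZ (2 * p) (2 * q) h z ∈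
      Submodule.map₂ (TensorProduct.mk K (W.obj X (2 * p)) (W.obj Z (2 * q))) (U' p) ⊤) :
    A = A' ↔ ∀ p q : ℕ, p + q = c → Nontrivial (W.obj Z (2 * q)) → U p = U' p := by
  rw [le_antisymm_iff, W.le_iff_of_kunneth_pieces hX hZ hA hA', W.le_iff_of_kunneth_pieces hX hZ hA' hA]
  exact ⟨fun h p q hpq hq ↦ le_antisymm (h.1 p q hpq hq) (h.2 p q hpq hq),
    fun h ↦ ⟨fun p q hpq hq ↦ (h p q hpq hq).le, fun p q hpq hq ↦ (h p q hpq hq).ge⟩⟩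

end WeilCohomology

namespace GaloisWeilCohomology

open Literature.LinearAlgebra.TensorContraction
open Literature.AlgebraicGeometry.Kahn2003 (HasPoleOfOrderAt)

variable {k : Type u} [Field k] {K : Type v} [Field K] [CharZero K]
  {χ : Field.absoluteGaloisGroup k →* Kˣ} (E : GaloisWeilCohomology k K χ)
variable {n m : ℕ} {X Z : SchemeOver k}

/-! ### §2 The `T′`-form `K·Aᶜ = Ker(g − 1)` transfers -/

/-- **`K·Aᶜ(X × Z) = Ker(g − 1 | H^{2c}(X × Z)(c))` iff `K·Aᵖ(X) = Ker(g − 1 | H^{2p}(X)(p))` for every `p + q = c`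
with `H^{2q}(Z) ≠ 0`** (`Z` with fully algebraic cohomology; `g ∈ Γ_k` arbitrary — for `k` finite and `g` the
Frobenius this is Milne's `T′`, the form of the Tate conjecture in Tate's Th. 2.9).
[cite: Milne1986ValuesZetaFunctionsFiniteFields, §8 T′(X, r, ℓ)] [cite: Tate1994, §2 Th. 2.9] [cite: Milne2007TateFiniteFieldsAIM, Cor. 2.2] -/
theorem algebraicClasses_eq_ker_sub_one_tensor_iff (hX : IsSmoothProjective n X) (hZ : IsSmoothProjective m Z)
    (hZalg : ∀ q, E.algebraicClasses Z q = ⊤) (hZodd : ∀ j, Odd j → Module.finrank K (E.obj Z j) = 0)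
    (g : Field.absoluteGaloisGroup k) (c : ℕ) :
    E.algebraicClasses (X ⊗ Z) c = LinearMap.ker (E.ρTwist (X ⊗ Z) (2 * c) c g - 1) ↔
      ∀ p q : ℕ, p + q = c → Nontrivial (E.obj Z (2 * q)) →
        E.algebraicClasses X p = LinearMap.ker (E.ρTwist X (2 * p) p g - 1) :=
  E.eq_iff_of_kunneth_pieces hX hZ (E.mem_algebraicClasses_tensor_iff hX hZ hZalg hZodd)
    (E.mem_ker_sub_one_tensor_iff hX hZ hZalg hZodd g)

/-! ### §3 Finite field: Tate's condition (b) and its consequences for `X × Z` -/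

section FiniteField

variable [Finite k]

/-- **Tate's condition (b) transfers from `X` to `X × Z`**: if `T′ʳ(X) ∧ T′ˢ(X) ∧ Sʳ(X)` holds for every
`r + s = n` (`n = dim X`; the Frobenius forms `K·A = Ker(φ − 1)`, `Ker(φ − 1) ∩ (φ − 1)H = 0`), then
`T′ᶜ(X × Z) ∧ T′^{c′}(X × Z) ∧ Sᶜ(X × Z)` holds for every `c`, `c′` (in particular for `c + c′ = n + m`), for `Z`
with fully algebraic cohomology (the pieces `p > n` are empty). [cite: Tate1994, §2 Th. 2.9 (b)] [cite: Milne2007TateFiniteFieldsAIM, Th. 1.2 and Cor. 2.2]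
[cite: Kahn2020, §6.14 Th. 6.53] -/
theorem tate_b_tensor_of_forall (hX : IsSmoothProjective n X) (hZ : IsSmoothProjective m Z)
    (hZalg : ∀ q, E.algebraicClasses Z q = ⊤) (hZodd : ∀ j, Odd j → Module.finrank K (E.obj Z j) = 0)
    (hb : ∀ r s : ℕ, r + s = n →
      E.algebraicClasses X r = LinearMap.ker (E.ρTwist X (2 * r) r (geomFrob k) - 1) ∧
        E.algebraicClasses X s = LinearMap.ker (E.ρTwist X (2 * s) s (geomFrob k) - 1) ∧
        LinearMap.ker (E.ρTwist X (2 * r) r (geomFrob k) - 1) ⊓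
          LinearMap.range (E.ρTwist X (2 * r) r (geomFrob k) - 1) = ⊥)
    (c c' : ℕ) :
    E.algebraicClasses (X ⊗ Z) c = LinearMap.ker (E.ρTwist (X ⊗ Z) (2 * c) c (geomFrob k) - 1) ∧
      E.algebraicClasses (X ⊗ Z) c' = LinearMap.ker (E.ρTwist (X ⊗ Z) (2 * c') c' (geomFrob k) - 1) ∧
      LinearMap.ker (E.ρTwist (X ⊗ Z) (2 * c) c (geomFrob k) - 1) ⊓
        LinearMap.range (E.ρTwist (X ⊗ Z) (2 * c) c (geomFrob k) - 1) = ⊥ := by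
  -- `T′ᵖ(X)` and `Sᵖ(X)` for every `p` (empty for `p > n`)
  have hT : ∀ p, E.algebraicClasses X p = LinearMap.ker (E.ρTwist X (2 * p) p (geomFrob k) - 1) := fun p ↦ by
    rcases Nat.lt_or_ge n p with hp | hp
    · haveI := E.subsingleton_obj hX (i := 2 * p) (by omega)
      exact Subsingleton.elim _ _
    · exact (hb p (n - p) (by omega)).1
  have hS : ∀ p, LinearMap.ker (E.ρTwist X (2 * p) p (geomFrob k) - 1) ⊓
      LinearMap.range (E.ρTwist X (2 * p) p (geomFrob k) - 1) = ⊥ := fun p ↦ by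
    rcases Nat.lt_or_ge n p with hp | hp
    · haveI := E.subsingleton_obj hX (i := 2 * p) (by omega)
      exact Subsingleton.elim _ _
    · exact (hb p (n - p) (by omega)).2.2
  exact ⟨(E.algebraicClasses_eq_ker_sub_one_tensor_iff hX hZ hZalg hZodd (geomFrob k) c).mpr
      fun p _ _ _ ↦ hT p,
    (E.algebraicClasses_eq_ker_sub_one_tensor_iff hX hZ hZalg hZodd (geomFrob k) c').mpr fun p _ _ _ ↦ hT p,
    (E.ker_inf_range_eq_bot_tensor_iff hX hZ hZalg hZodd (geomFrob k) c).mpr fun p _ _ _ ↦ hS p⟩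

/-- **Tate's theorem for `X × Z` from condition (b) for `X`**: for every `c + c′ = n + m`, `Tᶜ(X × Z)`, `T^{c′}(X × Z)`
(the tree's `Γ_k`-invariant form), hom = num with `ℚ`-coefficients in codimensions `c` and `c′` (the Poincaré
pairing `Aᶜ(X × Z)_ℚ × A^{c′}(X × Z)_ℚ → K` has trivial kernels), and `Sᶜ`, `S^{c′}` — by the tree's
`(b) ⟹ (a)` (`tate_a_iff_b`) and `consequences_of_tate_a` applied to `X × Z`.
[cite: Tate1994, §2 Th. 2.9] [cite: Milne2007TateFiniteFieldsAIM, Th. 1.2] [cite: Kahn2020, §6.14 Th. 6.53] -/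
theorem consequences_tensor_of_forall_tate_b (hX : IsSmoothProjective n X) (hZ : IsSmoothProjective m Z)
    (hZalg : ∀ q, E.algebraicClasses Z q = ⊤) (hZodd : ∀ j, Odd j → Module.finrank K (E.obj Z j) = 0)
    (hb : ∀ r s : ℕ, r + s = n →
      E.algebraicClasses X r = LinearMap.ker (E.ρTwist X (2 * r) r (geomFrob k) - 1) ∧
        E.algebraicClasses X s = LinearMap.ker (E.ρTwist X (2 * s) s (geomFrob k) - 1) ∧
        LinearMap.ker (E.ρTwist X (2 * r) r (geomFrob k) - 1) ⊓
          LinearMap.range (E.ρTwist X (2 * r) r (geomFrob k) - 1) = ⊥)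
    {c c' : ℕ} (hcc' : c + c' = n + m) (h : 2 * c + 2 * c' = 2 * (n + m)) (h' : 2 * c' + 2 * c = 2 * (n + m)) :
    E.TateConjectureFor (X ⊗ Z) c ∧ E.TateConjectureFor (X ⊗ Z) c' ∧
      (∀ x ∈ E.ratAlgebraicClasses (X ⊗ Z) c, (∀ y ∈ E.ratAlgebraicClasses (X ⊗ Z) c',
        E.cupPairing (X ⊗ Z) (n + m) (2 * c) (2 * c') h x y = 0) → x = 0) ∧
      (∀ y ∈ E.ratAlgebraicClasses (X ⊗ Z) c', (∀ x ∈ E.ratAlgebraicClasses (X ⊗ Z) c,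
        E.cupPairing (X ⊗ Z) (n + m) (2 * c') (2 * c) h' y x = 0) → y = 0) ∧
      LinearMap.ker (E.ρTwist (X ⊗ Z) (2 * c) c (geomFrob k) - 1) ⊓
          LinearMap.range (E.ρTwist (X ⊗ Z) (2 * c) c (geomFrob k) - 1) = ⊥ ∧
      LinearMap.ker (E.ρTwist (X ⊗ Z) (2 * c') c' (geomFrob k) - 1) ⊓
          LinearMap.range (E.ρTwist (X ⊗ Z) (2 * c') c' (geomFrob k) - 1) = ⊥ := by
  have hXZ := IsSmoothProjective.tensor_holds hX hZ
  obtain ⟨hT, hE⟩ := (E.tate_a_iff_b hXZ hcc' h).mpr (E.tate_b_tensor_of_forall hX hZ hZalg hZodd hb c c')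
  obtain ⟨h1, h2, h3, h4, h5⟩ := E.consequences_of_tate_a hXZ hcc' h h' hT hE
  exact ⟨h1, h2, hE, h3, h4, h5⟩

/-- **«order of the pole = rank» for `Z(X × Z, T)`** (Tate 1965 (12)): if Tate's condition (b) holds for `X` in all
pairs `(r, s)`, then for every `c + c′ = n + m` the pole of `Z(X × Z, T)` at `T = q^{−c}` has order exactly the rank
`ρ_c(X × Z)` of the Poincaré pairing on `K·Aᶜ(X × Z) × K·A^{c′}(X × Z)` — in `E` with the trace formula,
`χ(φ_arith) = q`, granted RH for `X` and `Z`. [cite: TateWoodsHole1965, §3 (12)] [cite: Tate1994, §2 Th. 2.9 (c)]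
[cite: Milne2007TateFiniteFieldsAIM, Th. 1.2] [cite: Kahn2020, §6.14 Conj. 6.52 and Th. 6.53] -/
theorem hasPoleOfOrderAt_zetaSeries_tensor_rank_of_forall_tate_b (hE : E.HasLefschetzTraceFormula)
    (hχ : ((χ (arithFrob k) : Kˣ) : K) = Nat.card k) (hX : IsSmoothProjective n X) (hZ : IsSmoothProjective m Z)
    (hZalg : ∀ q, E.algebraicClasses Z q = ⊤) (hZodd : ∀ j, Odd j → Module.finrank K (E.obj Z j) = 0)
    (hRHX : E.WeilRiemannHypothesisFor X n) (hRHZ : E.WeilRiemannHypothesisFor Z m)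
    (hb : ∀ r s : ℕ, r + s = n →
      E.algebraicClasses X r = LinearMap.ker (E.ρTwist X (2 * r) r (geomFrob k) - 1) ∧
        E.algebraicClasses X s = LinearMap.ker (E.ρTwist X (2 * s) s (geomFrob k) - 1) ∧
        LinearMap.ker (E.ρTwist X (2 * r) r (geomFrob k) - 1) ⊓
          LinearMap.range (E.ρTwist X (2 * r) r (geomFrob k) - 1) = ⊥)
    {c c' : ℕ} (hcc' : c + c' = n + m) (h : 2 * c + 2 * c' = 2 * (n + m)) :
    HasPoleOfOrderAt (zetaSeries (X ⊗ Z)) (((Nat.card k : ℚ) ^ c)⁻¹)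
      (Module.finrank K (LinearMap.range ((E.cupPairing (X ⊗ Z) (n + m) (2 * c) (2 * c') h).domRestrict₁₂
        (E.algebraicClasses (X ⊗ Z) c) (E.algebraicClasses (X ⊗ Z) c')))) :=
  (E.hasPoleOfOrderAt_zetaSeries_rank_iff' hE hχ (IsSmoothProjective.tensor_holds hX hZ)
    (E.weilRiemannHypothesisFor_tensor hX hZ hRHX hRHZ) hcc' h).mpr (E.tate_b_tensor_of_forall hX hZ hZalg hZodd hb c c')

/-! ### §4 `Z = 𝐏ʳ` -/

/-- **Tate's condition (b) for `X × 𝐏ʳ` from (b) for `X`** (over a finite field, RH for `𝐏ʳ` in `E`).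
[cite: Tate1994, §2 Th. 2.9 (b)] [cite: Milne2007TateFiniteFieldsAIM, Th. 1.2 and Cor. 2.2] [cite: Hartshorne1977, App. C Ex. 5.2] -/
theorem tate_b_tensor_projectiveSpace_of_forall (hE : E.HasLefschetzTraceFormula)
    (hχ : ((χ (arithFrob k) : Kˣ) : K) = Nat.card k) {r : ℕ}
    (hRH : E.WeilRiemannHypothesisFor (projectiveSpace r k) r) (hX : IsSmoothProjective n X)
    (hb : ∀ a s : ℕ, a + s = n →
      E.algebraicClasses X a = LinearMap.ker (E.ρTwist X (2 * a) a (geomFrob k) - 1) ∧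
        E.algebraicClasses X s = LinearMap.ker (E.ρTwist X (2 * s) s (geomFrob k) - 1) ∧
        LinearMap.ker (E.ρTwist X (2 * a) a (geomFrob k) - 1) ⊓
          LinearMap.range (E.ρTwist X (2 * a) a (geomFrob k) - 1) = ⊥)
    (c c' : ℕ) :
    E.algebraicClasses (X ⊗ projectiveSpace r k) c =
        LinearMap.ker (E.ρTwist (X ⊗ projectiveSpace r k) (2 * c) c (geomFrob k) - 1) ∧
      E.algebraicClasses (X ⊗ projectiveSpace r k) c' =
        LinearMap.ker (E.ρTwist (X ⊗ projectiveSpace r k) (2 * c') c' (geomFrob k) - 1) ∧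
      LinearMap.ker (E.ρTwist (X ⊗ projectiveSpace r k) (2 * c) c (geomFrob k) - 1) ⊓
        LinearMap.range (E.ρTwist (X ⊗ projectiveSpace r k) (2 * c) c (geomFrob k) - 1) = ⊥ :=
  E.tate_b_tensor_of_forall hX (isSmoothProjective_projectiveSpace_holds k r)
    (E.algebraicClasses_projectiveSpace_eq_top hE hχ hRH) (fun _ hj ↦ E.finrank_projectiveSpace_of_odd hE hχ hRH hj)
    hb c c'

/-- **«order of the pole = rank» for `Z(X × 𝐏ʳ, T)` at every `q^{−c}`, `c ≤ n + r`, from Tate's condition (b) for `X`**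
(trace formula, `χ(φ_arith) = q`, RH for `X` and `𝐏ʳ`). [cite: TateWoodsHole1965, §3 (12)–(13)] [cite: Tate1994, §2 Th. 2.9]
[cite: Milne2007TateFiniteFieldsAIM, Th. 1.2] -/
theorem hasPoleOfOrderAt_zetaSeries_tensor_projectiveSpace_rank_of_forall_tate_b (hE : E.HasLefschetzTraceFormula)
    (hχ : ((χ (arithFrob k) : Kˣ) : K) = Nat.card k) {r : ℕ}
    (hRH : E.WeilRiemannHypothesisFor (projectiveSpace r k) r) (hX : IsSmoothProjective n X)
    (hRHX : E.WeilRiemannHypothesisFor X n)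
    (hb : ∀ a s : ℕ, a + s = n →
      E.algebraicClasses X a = LinearMap.ker (E.ρTwist X (2 * a) a (geomFrob k) - 1) ∧
        E.algebraicClasses X s = LinearMap.ker (E.ρTwist X (2 * s) s (geomFrob k) - 1) ∧
        LinearMap.ker (E.ρTwist X (2 * a) a (geomFrob k) - 1) ⊓
          LinearMap.range (E.ρTwist X (2 * a) a (geomFrob k) - 1) = ⊥)
    {c c' : ℕ} (hcc' : c + c' = n + r) (h : 2 * c + 2 * c' = 2 * (n + r)) :
    HasPoleOfOrderAt (zetaSeries (X ⊗ projectiveSpace r k)) (((Nat.card k : ℚ) ^ c)⁻¹)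
      (Module.finrank K (LinearMap.range ((E.cupPairing (X ⊗ projectiveSpace r k) (n + r) (2 * c) (2 * c') h).domRestrict₁₂
        (E.algebraicClasses (X ⊗ projectiveSpace r k) c) (E.algebraicClasses (X ⊗ projectiveSpace r k) c')))) :=
  E.hasPoleOfOrderAt_zetaSeries_tensor_rank_of_forall_tate_b hE hχ hX (isSmoothProjective_projectiveSpace_holds k r)
    (E.algebraicClasses_projectiveSpace_eq_top hE hχ hRH) (fun _ hj ↦ E.finrank_projectiveSpace_of_odd hE hχ hRH hj)
    hRHX hRH hb hcc' h

end FiniteField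

end GaloisWeilCohomology

end Literature.AlgebraicGeometry.Motives

end
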